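import Summits.QuantumFields.YangMills.Theorems.SmallCircleAnchorAnchorGapStubDebyeScreening20
import Literature.MathematicalPhysics.QuantumFieldTheory.PolymerCombinatorics

/-!
# Crux `AnchorGap` (stmt-QuantumFields-11141), line `registered` — the two ends of the polymer representation (B2/B3 under stub X₀)

* `gaussian_integral_prod_factorizes`, `gaussian_expect_prod_factorizes` — the fully decoupled
  corner of the decoupling expansion: for a precision matrix with no entries between different
  blocks of a labelling `blk : ι → β` and block-local factors `F_b`,
  `⟨Π_{b∈T} F_b⟩_Q = Π_{b∈T} ⟨F_b⟩_Q` (iteration of `gaussian_integral_factorizes` of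
  `…StubDebyeScreening20` over the blocks) — the product over polymers;
* `kp_of_pow_bound` — the Kotecký–Preiss smallness in the format of the remaining core (KP-DH)
  from an exponential activity bound: if `|K(X)| ≤ A η^{|X|}` on connected block sets and
  `η e^{κ} e^{Dθ} ≤ θ` (`D` a degree bound of the block adjacency), then
  `Σ_{X ∋ a connected} |K(X)| e^{κ|X|} ≤ A θ` uniformly in the region (the tree's entropy bound
  `Polymer.sum_isConn_pow_card_le`).
-/

set_option autoImplicit false

noncomputable section

namespace Summit.QuantumFields.YangMills.Theorems.AnchorGap

open MeasureTheory Finset Matrix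
open Literature.MathematicalPhysics.QuantumFieldTheory

/-- **Full factorisation over blocks (un-normalised).** If `Q` has no entries between coordinates
with different labels and each `F_b` depends only on the coordinates labelled `b`, then
`(∫ (Π_{b∈T} F_b) e^{−½φᵀQφ}) · Z^{|T|} = Z · Π_{b∈T} ∫ F_b e^{−½φᵀQφ}`, `Z = ∫ e^{−½φᵀQφ}`
(induction on `T` with `gaussian_integral_factorizes`; no integrability hypotheses). [folklore] -/
theorem gaussian_integral_prod_factorizes :
    ∀ (ι : Type) [Fintype ι] [DecidableEq ι] (β : Type) [DecidableEq β] (blk : ι → β) (Q : Matrix ι ι ℝ), (∀ i j : ι, blk i ≠ blk j → Q i j = 0) → ∀ (F : β → (ι → ℝ) → ℝ), (∀ (b : β) (φ ψ : ι → ℝ), (∀ i : ι, blk i = b → φ i = ψ i) → F b φ = F b ψ) → ∀ T : Finset β, (∫ φ : ι → ℝ, (∏ b ∈ T, F b φ) * Real.exp (-(φ ⬝ᵥ (Q *ᵥ φ)) / 2)) * (∫ φ : ι → ℝ, Real.exp (-(φ ⬝ᵥ (Q *ᵥ φ)) / 2)) ^ T.card = (∫ φ : ι → ℝ, Real.exp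 (-(φ ⬝ᵥ (Q *ᵥ φ)) / 2)) * ∏ b ∈ T, ∫ φ : ι → ℝ, F b φ * Real.exp (-(φ ⬝ᵥ (Q *ᵥ φ)) / 2) := by
  intro ι _ _ β _ blk Q hQ F hF T
  induction T using Finset.induction_on with
  | empty => simp
  | @insert b₀ T' hb₀ ih =>
    rw [Finset.card_insert_of_notMem hb₀, pow_succ, Finset.prod_insert hb₀]
    simp_rw [Finset.prod_insert hb₀]
    -- decouple the block `b₀` from the rest
    set S : Finset ι := Finset.univ.filter fun i => blk i = b₀ with hS
    have hSmem : ∀ i : ι, i ∈ S ↔ blk i = b₀ := fun i => by simp [hS]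
    have hQS : ∀ i j : ι, ¬ (i ∈ S ↔ j ∈ S) → Q i j = 0 := by
      intro i j h
      refine hQ i j fun hij => h ?_
      rw [hSmem, hSmem, hij]
    have hFloc : ∀ φ ψ : ι → ℝ, (∀ i ∈ S, φ i = ψ i) → F b₀ φ = F b₀ ψ :=
      fun φ ψ h => hF b₀ φ ψ fun i hi => h i ((hSmem i).2 hi)
    have hGloc : ∀ φ ψ : ι → ℝ, (∀ i, i ∉ S → φ i = ψ i) → (∏ b ∈ T', F b φ) = ∏ b ∈ T', F b ψ := by
      intro φ ψ h
      refine Finset.prod_congr rfl fun b hb => hF b φ ψ fun i hi => h i fun hiS => ?_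
      rw [hSmem] at hiS
      exact hb₀ (by rw [← hiS, hi]; exact hb)
    have hfac := gaussian_integral_factorizes ι Q S hQS (F b₀) (fun φ => ∏ b ∈ T', F b φ) hFloc hGloc
    calc (∫ φ : ι → ℝ, F b₀ φ * (∏ b ∈ T', F b φ) * Real.exp (-(φ ⬝ᵥ (Q *ᵥ φ)) / 2)) *
          ((∫ φ : ι → ℝ, Real.exp (-(φ ⬝ᵥ (Q *ᵥ φ)) / 2)) ^ T'.card * ∫ φ : ι → ℝ, Real.exp (-(φ ⬝ᵥ (Q *ᵥ φ)) / 2))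
        = ((∫ φ : ι → ℝ, F b₀ φ * (∏ b ∈ T', F b φ) * Real.exp (-(φ ⬝ᵥ (Q *ᵥ φ)) / 2)) *
            ∫ φ : ι → ℝ, Real.exp (-(φ ⬝ᵥ (Q *ᵥ φ)) / 2)) * (∫ φ : ι → ℝ, Real.exp (-(φ ⬝ᵥ (Q *ᵥ φ)) / 2)) ^ T'.card := by
          ring
      _ = (∫ φ : ι → ℝ, F b₀ φ * Real.exp (-(φ ⬝ᵥ (Q *ᵥ φ)) / 2)) *
            ((∫ φ : ι → ℝ, (∏ b ∈ T', F b φ) * Real.exp (-(φ ⬝ᵥ (Q *ᵥ φ)) / 2)) *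
              (∫ φ : ι → ℝ, Real.exp (-(φ ⬝ᵥ (Q *ᵥ φ)) / 2)) ^ T'.card) := by
          rw [hfac]; ring
      _ = (∫ φ : ι → ℝ, Real.exp (-(φ ⬝ᵥ (Q *ᵥ φ)) / 2)) *
            ((∫ φ : ι → ℝ, F b₀ φ * Real.exp (-(φ ⬝ᵥ (Q *ᵥ φ)) / 2)) *
              ∏ b ∈ T', ∫ φ : ι → ℝ, F b φ * Real.exp (-(φ ⬝ᵥ (Q *ᵥ φ)) / 2)) := by
          rw [ih]; ring

/-- **Full factorisation over blocks (normalised expectations).** Under the hypotheses of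
`gaussian_integral_prod_factorizes` with `Q` positive definite,
`⟨Π_{b∈T} F_b⟩_Q = Π_{b∈T} ⟨F_b⟩_Q`: the fully decoupled Gaussian makes block-local factors
independent — the terminal step of the decoupling expansion, giving the product over polymers.
[folklore] -/
theorem gaussian_expect_prod_factorizes :
    ∀ (ι : Type) [Fintype ι] [DecidableEq ι] (β : Type) [DecidableEq β] (blk : ι → β) (Q : Matrix ι ι ℝ), Q.PosDef → (∀ i j : ι, blk i ≠ blk j → Q i j = 0) → ∀ (F : β → (ι → ℝ) → ℝ), (∀ (b : β) (φ ψ : ι → ℝ), (∀ i : ι, blk i = b → φ i = ψ i) → F b φ = F b ψ) → ∀ T : Finset β, (∫ φ : ι → ℝ, (∏ b ∈ T, F b φ) * Real.exp (-(φ ⬝ᵥ (Q *ᵥ φ)) / 2)) / (∫ φ : ι → ℝ, Real.exp (-(φ ⬝ᵥ (Q *ᵥ φ)) / 2)) = ∏ b ∈ T, (∫ φ : ι → ℝ, F b φ * Real.exp (-(φ ⬝ᵥ (Q *ᵥ φ)) / 2)) / ∫ φ : ι → ℝ, Real.exp (-(φ ⬝ᵥ (Q *ᵥ φ)) / 2)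 := by
  intro ι _ _ β _ blk Q hQpd hQ F hF T
  have hZ := (gaussian_second_moment ι Q hQpd).1
  have h := gaussian_integral_prod_factorizes ι β blk Q hQ F hF T
  set Z : ℝ := ∫ φ : ι → ℝ, Real.exp (-(φ ⬝ᵥ (Q *ᵥ φ)) / 2) with hZdef
  have hZT : Z ^ T.card ≠ 0 := pow_ne_zero _ hZ.ne'
  rw [Finset.prod_div_distrib, Finset.prod_const, div_eq_iff hZ.ne', div_mul_eq_mul_div, eq_div_iff hZT, h]
  ring

open Classical in
/-- **Kotecký–Preiss smallness from an exponential activity bound.** Let `adj` be a symmetric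
adjacency on blocks with degrees `≤ D`, and let `K` be an activity on finite block sets with
`|K(X)| ≤ A η^{|X|}` (`A, η ≥ 0`).  If `η e^{κ} e^{Dθ} ≤ θ` then, for every region `P` and root `a`,
`Σ_{X ⊆ P, X ∋ a connected} |K(X)| e^{κ|X|} ≤ A θ` — the condition (KP) of the remaining core,
uniformly in the region (`Polymer.sum_isConn_pow_card_le`). [folklore] -/
theorem kp_of_pow_bound :
    ∀ (α : Type) (adj : α → α → Prop) [Std.Symm adj] (D : ℕ), (∀ (a : α) (P : Finset α), (P.filter (adj a)).card ≤ D) → ∀ (K : Finset α → ℝ) (A η κ θ : ℝ), 0 ≤ A → 0 ≤ η → η * Real.exp κ * Real.exp (D * θ) ≤ θ → ∀ (P : Finset α), (∀ X ∈ P.powerset, |K X| ≤ A * η ^ X.card) → ∀ a : α, ∑ X ∈ P.powerset.filter (fun X => Polymer.IsConn adj X a), |K X| * Real.exp (κ * X.card) ≤ A * θ := by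
  intro α adj _ D hD K A η κ θ hA hη hsmall P hK a
  have hx : 0 ≤ η * Real.exp κ := by positivity
  have hent := Polymer.sum_isConn_pow_card_le D hD hx hsmall P a
  calc ∑ X ∈ P.powerset.filter (fun X => Polymer.IsConn adj X a), |K X| * Real.exp (κ * X.card)
      ≤ ∑ X ∈ P.powerset.filter (fun X => Polymer.IsConn adj X a), A * (η * Real.exp κ) ^ X.card := by
        refine Finset.sum_le_sum fun X hX => ?_
        have hXP : X ∈ P.powerset := (Finset.mem_filter.1 hX).1
        rw [mul_pow, ← Real.exp_nat_mul, mul_comm (X.card : ℝ) κ, ← mul_assoc]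
        exact mul_le_mul_of_nonneg_right (hK X hXP) (Real.exp_pos _).le
    _ = A * ∑ X ∈ P.powerset.filter (fun X => Polymer.IsConn adj X a), (η * Real.exp κ) ^ X.card := by
        rw [Finset.mul_sum]
    _ ≤ A * θ := mul_le_mul_of_nonneg_left hent hA

end Summit.QuantumFields.YangMills.Theorems.AnchorGap

end
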